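/-
Copyright (c) 2026 the pub-hodgecm-mathlib formalisation cell (harness21).  Prover seat hodgecm-mathlib-F0P3a-p08 (g20): road «S3-ram» (LEAD F0P3a-plan (g13);
owner F0P3a-p06), (T2) G-side organ (Cnt2′), organ (z6) «FIX-FINITE, BLOCK LITERAL», part (z6-i) «CONFORMALITY OF `γ₁ − u·1` EXPORTED» (request of the `stub_Zaniso`
composition pen A-p16 (g33), 2026-09-02T04:21:30Z); 2026-09-02.
-/
import Literature.NumberTheory.Automorphic.UnitaryLatticeTreeAnisotropicBlockNonContraction   -- ★ p848962∕p849081 (this seat): §2–§3 unitarity relations, `valued_disc_eq_max_sq_of_unitary_anisotropic`, `eval_charpoly_fin_two_eq_det_sub_smul_one`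
import HarnessLib

/-!
# `γ − u·1` is CONFORMAL for `γ` unitary for a residually anisotropic unimodular plane: every entry squared is bounded by the determinant, so the block depth is read off
# `|det(γ − u·1)| = |χ_γ(u)|` (Bruhat–Tits 1972 §10; Kottwitz 1986 §3)

Topic `NumberTheory/Automorphic`; namespace `Literature.NumberTheory.Automorphic.UnitaryLatticeTree`.  THEOREMS ONLY (no definition, no instance, no notation, no named fact,
no `sorry`); kernel lane `--supports stmt-HodgeConjecture-24833`; datum-free (`K` with `Valued K ℤᵐ⁰`, `σ` valuation-preserving, `|2| = 1`, principal units are squares).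
Cell `pub/hodgecm-mathlib` (D-0151), crux H413; road «S3-ram» (Literature seeding, count-neutral); (T2) G-side organ (Cnt2′), organ **(z6)**, part **(z6-i)**: the internal
conformality step of ★ `exists_le_valued_sub_smul_one_mulVec_of_le_entry` (ED. 2 of `…AnisotropicBlockNonContraction`) EXPORTED as a standalone head, as asked by the
`stub_Zaniso` composition pen A-p16 (g33): with it the socket-side EQUALITY `|det(γ₁ − u₀₀·1)| = |ϖ|^{2d₀}` (`det(γ₁ − u·1) = χ_{γ₁}(u) = χ_{g_w}(u_w)`, spectral tie) yields BOTH
the block-depth upper bound `hγd : ∀ i j, |(γ₁ − u₀₀·1) i j| ≤ |ϖ|^{d₀}` and the lower bound `hA′ : ∃ i j, |ϖ|^{d₀} ≤ |(γ₁ − u₀₀·1) i j|` (ultrametric `|det| ≤ ‖T‖²`).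

THE MATHEMATICS (= ★ ED. 2, §5): `T := γ − u·1`, `2T = s·1 + Z`, `s = tr γ − 2u`, `Z = !![a, b; b′, −a]` with `|b′| = |b|` (★ unitarity relations), `|disc γ| = max(|a|,|b|)² = m²`
(★ no cancellation by anisotropy); every entry of `T` has size `≤ R := max(|s|, m)` and `|4 det T| = |s² − disc γ| = R²` in all three regimes (`|s| < m`, `|s| > m` ultrametric;
`|s| = m` because a cancellation would make `disc γ` a square, i.e. `χ_γ` would have a root).  Hence `|T i j|² ≤ R² = |det T|`, and `|det T| = max_{i,j} |T i j|²`.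

* **`forall_valued_sub_smul_one_apply_mul_self_le_det`** (`∀ i j, |T i j|·|T i j| ≤ |det T|`), **`valued_det_sub_smul_one_eq_max_sq`** (`|det T| = (max |T i j|)²` as
  `∃ i j, |det T| = |T i j|·|T i j| ∧ ∀ k l, |T k l| ≤ |T i j|`), `forall_valued_sub_smul_one_apply_le_of_valued_det_le` ∕ `exists_le_valued_sub_smul_one_apply_of_le_valued_det`
  (the two block-depth bounds from a determinant bound: `|det T| ≤ μ² ⇒ ∀ |T i j| ≤ μ`, `μ² ≤ |det T| ⇒ ∃ |T i j| ≥ μ`).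

HONEST LABEL: HC_CM is proved only modulo the 2 remaining named inputs (hLiu418 24832, h413 24833) until rung 0 closes; nothing printed is asserted here (elementary valuation
algebra); «S3-ram» has no books consequence.

## References
* [BruhatTits1972] F. Bruhat, J. Tits, *Groupes réductifs sur un corps local I*, Publ. Math. IHÉS 41 (1972), §10.
* [Kottwitz1986] R. E. Kottwitz, *Base change for unit elements of Hecke algebras*, Compositio Math. 60 (1986), §3.
* [Jacobowitz1962] R. Jacobowitz, *Hermitian forms over local fields*, Amer. J. Math. 84 (1962), §7.
* [Rogawski1990] J. D. Rogawski, *Automorphic Representations of Unitary Groups in Three Variables*, Ann. of Math. Stud. 123 (1990), §4.9 pp. 54–56.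
-/

set_option autoImplicit false

noncomputable section

open scoped Valued WithZero Matrix MatrixGroups

namespace Literature.NumberTheory.Automorphic.UnitaryLatticeTree

open Literature.NumberTheory.Automorphic Literature.NumberTheory.Automorphic.HermitianLattice Literature.NumberTheory.Rogawski1990

variable {K : Type*} [Field K] [Valued K ℤᵐ⁰]

/-- In `ℤᵐ⁰`: `x·x ≤ y·y ⇒ x ≤ y`. [folklore] -/
private theorem le_of_mul_self_le_mul_self_withZero' {x y : ℤᵐ⁰} (h : x * x ≤ y * y) : x ≤ y := by
  by_contra hlt
  rw [not_le] at hlt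
  rcases eq_or_ne x 0 with hx | hx
  · rw [hx] at hlt; exact absurd hlt (not_lt.2 zero_le)
  · exact absurd h (not_le.2 (lt_of_le_of_lt (mul_le_mul' le_rfl hlt.le) (mul_lt_mul_of_pos_right hlt (zero_lt_iff.2 hx))))

set_option maxHeartbeats 800000 in
-- budget only: many valuation case splits.
/-- **`γ − u·1` IS CONFORMAL: EVERY ENTRY SQUARED IS AT MOST THE DETERMINANT** — for `γ ∈ U(σ, diag d)` (`diag d` residually anisotropic), `|2| = 1`, principal units
squares (`hsq`), `χ_γ` rootless in `K` (`hirr`), any scalar `u`: `∀ i j, |(γ − u·1) i j|·|(γ − u·1) i j| ≤ |det(γ − u·1)|`.  (All entries are `≤ R = max(|tr γ − 2u|, √|disc γ|)`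
and `|det| = R²`; the export of ★ ED. 2's internal step, asked by the `stub_Zaniso` composition pen.) [cite: BruhatTits1972, §10] [cite: Kottwitz1986, §3] -/
theorem forall_valued_sub_smul_one_apply_mul_self_le_det {σ : K →+* K} (hvσ : ∀ a, Valued.v (σ a) = Valued.v a) (h2 : Valued.v (2 : K) = 1)
    (hsq : ∀ t : K, Valued.v (t - 1) < 1 → IsSquare t)
    {d : Fin 2 → K} (hd : ∀ i, Valued.v (d i) = 1)
    (hanis₀ : ∀ c : K, Valued.v c ≤ 1 → Valued.v (d 0 + d 1 * (σ c * c)) = 1)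
    (hanis₁ : ∀ c : K, Valued.v c ≤ 1 → Valued.v (d 0 * (σ c * c) + d 1) = 1)
    {γ : Matrix (Fin 2) (Fin 2) K} (hU : (γ.map σ)ᵀ * Matrix.diagonal d * γ = Matrix.diagonal d)
    (hirr : ∀ x : K, ¬ γ.charpoly.IsRoot x) (u : K) :
    ∀ i j, Valued.v ((γ - u • (1 : Matrix (Fin 2) (Fin 2) K)) i j) * Valued.v ((γ - u • (1 : Matrix (Fin 2) (Fin 2) K)) i j) ≤
      Valued.v (γ - u • (1 : Matrix (Fin 2) (Fin 2) K)).det := by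
  have h20 : (2 : K) ≠ 0 := fun h => by rw [h, map_zero] at h2; exact zero_ne_one h2
  have h4 : Valued.v (4 : K) = 1 := by rw [show (4 : K) = 2 * 2 by norm_num, map_mul, h2, one_mul]
  -- names
  set T : Matrix (Fin 2) (Fin 2) K := γ - u • (1 : Matrix (Fin 2) (Fin 2) K) with hT
  set a : K := γ 0 0 - γ 1 1 with ha
  set s : K := γ 0 0 + γ 1 1 - 2 * u with hs
  set e : K := γ.trace ^ 2 - 4 * γ.det with he
  set m : ℤᵐ⁰ := max (Valued.v a) (Valued.v (γ 0 1)) with hm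
  have hem : Valued.v e = m * m := valued_disc_eq_max_sq_of_unitary_anisotropic hvσ h2 hd hanis₀ hanis₁ hU
  have h10 : Valued.v (γ 1 0) = Valued.v (γ 0 1) := valued_apply_one_zero_eq_of_unitary_diagonal_two hvσ hd hU
  -- entries of `T` and `4 det T = s² − e`
  have hT00 : T 0 0 = γ 0 0 - u := by simp [hT]
  have hT11 : T 1 1 = γ 1 1 - u := by simp [hT]
  have hT01 : T 0 1 = γ 0 1 := by simp [hT]
  have hT10 : T 1 0 = γ 1 0 := by simp [hT]
  have hsa : s + a = 2 * (γ 0 0 - u) := by rw [hs, ha]; ring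
  have hsa' : s - a = 2 * (γ 1 1 - u) := by rw [hs, ha]; ring
  have hdetT : 4 * T.det = s ^ 2 - e := by
    rw [Matrix.det_fin_two, hT00, hT11, hT01, hT10, he, Matrix.trace_fin_two, Matrix.det_fin_two, hs]; ring
  have hvT00 : Valued.v (T 0 0) = Valued.v (s + a) := by rw [hsa, map_mul, h2, one_mul, hT00]
  have hvT11 : Valued.v (T 1 1) = Valued.v (s - a) := by rw [hsa', map_mul, h2, one_mul, hT11]
  have hvdetT : Valued.v T.det = Valued.v (s ^ 2 - e) := by rw [← hdetT, map_mul, h4, one_mul]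
  -- `R := max(|s|, m)` bounds the entries of `T`
  set R : ℤᵐ⁰ := max (Valued.v s) m with hR
  have ha_le : Valued.v a ≤ m := le_max_left _ _
  have hb_le : Valued.v (γ 0 1) ≤ m := le_max_right _ _
  have hent : ∀ i j, Valued.v (T i j) ≤ R := fun i j => by
    fin_cases i <;> fin_cases j
    · change Valued.v (T 0 0) ≤ R
      rw [hvT00]; exact (Valuation.map_add_le _ (le_max_left _ _) (ha_le.trans (le_max_right _ _)))
    · change Valued.v (T 0 1) ≤ R
      rw [hT01]; exact hb_le.trans (le_max_right _ _)
    · change Valued.v (T 1 0) ≤ R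
      rw [hT10, h10]; exact hb_le.trans (le_max_right _ _)
    · change Valued.v (T 1 1) ≤ R
      rw [hvT11]; exact (Valuation.map_sub_le _ (le_max_left _ _) (ha_le.trans (le_max_right _ _)))
  -- if `R = 0` everything vanishes
  rcases eq_or_ne R 0 with hR0 | hR0
  · intro i j
    have h0 : Valued.v (T i j) = 0 := le_antisymm (by rw [← hR0]; exact hent i j) zero_le
    rw [h0, zero_mul]; exact zero_le
  -- `|det T| = R²` (conformality, all three regimes)
  have hvs2 : Valued.v (s ^ 2) = Valued.v s * Valued.v s := by rw [map_pow, pow_two]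
  have hdet : R * R ≤ Valued.v T.det := by
    rw [hvdetT]
    rcases lt_trichotomy (Valued.v s) m with hlt | heq | hgt
    · have hR' : R = m := max_eq_right hlt.le
      have hm0 : m ≠ 0 := by rw [← hR']; exact hR0
      have hlt2 : Valued.v (s ^ 2) < Valued.v e := by
        rw [hvs2, hem]
        exact lt_of_le_of_lt (mul_le_mul' le_rfl hlt.le) (mul_lt_mul_of_pos_right hlt (zero_lt_iff.2 hm0))
      rw [Valuation.map_sub_eq_of_lt_right _ hlt2, hem, hR']
    · have hR' : R = m := by rw [hR, heq, max_self]
      have hm0 : m ≠ 0 := by rw [← hR']; exact hR0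
      rw [hR']
      by_contra hlt
      rw [not_le] at hlt
      have hs0 : s ≠ 0 := fun h0 => hm0 (by rw [← heq, h0, map_zero])
      have hvs : Valued.v (s ^ 2) = m * m := by rw [hvs2, heq]
      have ht1 : Valued.v (e / s ^ 2 - 1) < 1 := by
        have hs20 : s ^ 2 ≠ 0 := pow_ne_zero 2 hs0
        rw [div_sub_one hs20, map_div₀, hvs, ← Valuation.map_neg, neg_sub]
        have hpos : (0 : ℤᵐ⁰) < m * m := zero_lt_iff.2 (mul_ne_zero hm0 hm0)
        rwa [div_lt_one₀ hpos]
      obtain ⟨r, hr⟩ := hsq _ ht1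
      have hw : (r * s) * (r * s) = γ.trace ^ 2 - 4 * γ.det := by
        rw [← he]
        have hs20 : s ^ 2 ≠ 0 := pow_ne_zero 2 hs0
        have : e = r * r * s ^ 2 := by rw [← hr, div_mul_cancel₀ e hs20]
        rw [this]; ring
      refine hirr ((γ.trace + r * s) / 2) ?_
      rw [Polynomial.IsRoot.def, eval_charpoly_fin_two_eq_det_sub_smul_one, Matrix.det_fin_two]
      simp only [Matrix.sub_apply, Matrix.smul_apply, Matrix.one_apply_eq, Matrix.one_apply_ne (by decide : (0 : Fin 2) ≠ 1),
        Matrix.one_apply_ne (by decide : (1 : Fin 2) ≠ 0), smul_eq_mul, mul_one, mul_zero, sub_zero]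
      rw [Matrix.trace_fin_two, Matrix.det_fin_two] at hw
      rw [Matrix.trace_fin_two]
      field_simp
      linear_combination hw
    · have hR' : R = Valued.v s := max_eq_left hgt.le
      have hlt2 : Valued.v e < Valued.v (s ^ 2) := by
        rw [hvs2, hem]
        exact lt_of_le_of_lt (mul_le_mul' le_rfl hgt.le) (mul_lt_mul_of_pos_right hgt (lt_of_le_of_lt zero_le hgt))
      rw [Valuation.map_sub_eq_of_lt_left _ hlt2, hvs2, hR']
  intro i j
  exact (mul_le_mul' (hent i j) (hent i j)).trans hdet

/-- **`|det(γ − u·1)| = (max entry)²`**: some entry of `T = γ − u·1` attains `|T i j|² = |det T|` and dominates all others. [cite: BruhatTits1972, §10] [cite: Kottwitz1986, §3] -/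
theorem valued_det_sub_smul_one_eq_max_sq {σ : K →+* K} (hvσ : ∀ a, Valued.v (σ a) = Valued.v a) (h2 : Valued.v (2 : K) = 1)
    (hsq : ∀ t : K, Valued.v (t - 1) < 1 → IsSquare t)
    {d : Fin 2 → K} (hd : ∀ i, Valued.v (d i) = 1)
    (hanis₀ : ∀ c : K, Valued.v c ≤ 1 → Valued.v (d 0 + d 1 * (σ c * c)) = 1)
    (hanis₁ : ∀ c : K, Valued.v c ≤ 1 → Valued.v (d 0 * (σ c * c) + d 1) = 1)
    {γ : Matrix (Fin 2) (Fin 2) K} (hU : (γ.map σ)ᵀ * Matrix.diagonal d * γ = Matrix.diagonal d)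
    (hirr : ∀ x : K, ¬ γ.charpoly.IsRoot x) (u : K) :
    ∃ i j, Valued.v (γ - u • (1 : Matrix (Fin 2) (Fin 2) K)).det =
        Valued.v ((γ - u • (1 : Matrix (Fin 2) (Fin 2) K)) i j) * Valued.v ((γ - u • (1 : Matrix (Fin 2) (Fin 2) K)) i j) ∧
      ∀ k l, Valued.v ((γ - u • (1 : Matrix (Fin 2) (Fin 2) K)) k l) ≤ Valued.v ((γ - u • (1 : Matrix (Fin 2) (Fin 2) K)) i j) := by
  set T : Matrix (Fin 2) (Fin 2) K := γ - u • (1 : Matrix (Fin 2) (Fin 2) K) with hT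
  have hconf := forall_valued_sub_smul_one_apply_mul_self_le_det hvσ h2 hsq hd hanis₀ hanis₁ hU hirr u
  -- an entry of maximal size
  have hex : ∃ i j, ∀ k l, Valued.v (T k l) ≤ Valued.v (T i j) := by
    obtain ⟨p, -, hp⟩ := Finset.exists_max_image (Finset.univ : Finset (Fin 2 × Fin 2)) (fun p => Valued.v (T p.1 p.2)) ⟨(0, 0), Finset.mem_univ _⟩
    exact ⟨p.1, p.2, fun k l => hp (k, l) (Finset.mem_univ _)⟩
  obtain ⟨i, j, hij⟩ := hex
  refine ⟨i, j, le_antisymm ?_ (hconf i j), hij⟩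
  -- `|det T| ≤ (max entry)²` (ultrametric)
  rw [Matrix.det_fin_two]
  refine Valuation.map_sub_le _ ?_ ?_
  · rw [map_mul]; exact mul_le_mul' (hij 0 0) (hij 1 1)
  · rw [map_mul]; exact mul_le_mul' (hij 0 1) (hij 1 0)

/-- **BLOCK-DEPTH UPPER BOUND FROM A DETERMINANT BOUND**: `|det(γ − u·1)| ≤ μ·μ ⇒ ∀ i j, |(γ − u·1) i j| ≤ μ` (conformality). [cite: Kottwitz1986, §3] -/
theorem forall_valued_sub_smul_one_apply_le_of_valued_det_le {σ : K →+* K} (hvσ : ∀ a, Valued.v (σ a) = Valued.v a) (h2 : Valued.v (2 : K) = 1)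
    (hsq : ∀ t : K, Valued.v (t - 1) < 1 → IsSquare t)
    {d : Fin 2 → K} (hd : ∀ i, Valued.v (d i) = 1)
    (hanis₀ : ∀ c : K, Valued.v c ≤ 1 → Valued.v (d 0 + d 1 * (σ c * c)) = 1)
    (hanis₁ : ∀ c : K, Valued.v c ≤ 1 → Valued.v (d 0 * (σ c * c) + d 1) = 1)
    {γ : Matrix (Fin 2) (Fin 2) K} (hU : (γ.map σ)ᵀ * Matrix.diagonal d * γ = Matrix.diagonal d)
    (hirr : ∀ x : K, ¬ γ.charpoly.IsRoot x) (u : K) {μ : ℤᵐ⁰} (hμ : Valued.v (γ - u • (1 : Matrix (Fin 2) (Fin 2) K)).det ≤ μ * μ) :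
    ∀ i j, Valued.v ((γ - u • (1 : Matrix (Fin 2) (Fin 2) K)) i j) ≤ μ := fun i j =>
  le_of_mul_self_le_mul_self_withZero' ((forall_valued_sub_smul_one_apply_mul_self_le_det hvσ h2 hsq hd hanis₀ hanis₁ hU hirr u i j).trans hμ)

/-- **BLOCK-DEPTH LOWER BOUND FROM A DETERMINANT BOUND**: `μ·μ ≤ |det(γ − u·1)| ⇒ ∃ i j, μ ≤ |(γ − u·1) i j|` (ultrametric; no unitarity needed beyond the statement's
uniformity — proved from `valued_det_sub_smul_one_eq_max_sq`). [cite: Kottwitz1986, §3] -/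
theorem exists_le_valued_sub_smul_one_apply_of_le_valued_det {σ : K →+* K} (hvσ : ∀ a, Valued.v (σ a) = Valued.v a) (h2 : Valued.v (2 : K) = 1)
    (hsq : ∀ t : K, Valued.v (t - 1) < 1 → IsSquare t)
    {d : Fin 2 → K} (hd : ∀ i, Valued.v (d i) = 1)
    (hanis₀ : ∀ c : K, Valued.v c ≤ 1 → Valued.v (d 0 + d 1 * (σ c * c)) = 1)
    (hanis₁ : ∀ c : K, Valued.v c ≤ 1 → Valued.v (d 0 * (σ c * c) + d 1) = 1)
    {γ : Matrix (Fin 2) (Fin 2) K} (hU : (γ.map σ)ᵀ * Matrix.diagonal d * γ = Matrix.diagonal d)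
    (hirr : ∀ x : K, ¬ γ.charpoly.IsRoot x) (u : K) {μ : ℤᵐ⁰} (hμ : μ * μ ≤ Valued.v (γ - u • (1 : Matrix (Fin 2) (Fin 2) K)).det) :
    ∃ i j, μ ≤ Valued.v ((γ - u • (1 : Matrix (Fin 2) (Fin 2) K)) i j) := by
  obtain ⟨i, j, hdet, -⟩ := valued_det_sub_smul_one_eq_max_sq hvσ h2 hsq hd hanis₀ hanis₁ hU hirr u
  exact ⟨i, j, le_of_mul_self_le_mul_self_withZero' (by rw [← hdet]; exact hμ)⟩

end Literature.NumberTheory.Automorphic.UnitaryLatticeTree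

end
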